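import Mathlib
import HarnessLib
import Summits.Ventures.LatticeQCDFlow.Scoring.IndependentSumLimit
import Summits.Ventures.LatticeQCDFlow.Scoring.CramerWoldDevice

/-!
# JOINT convergence of a FINITE FAMILY of INDEPENDENT real statistics — the vector of `R`
# independent replicas' statistics converges in `EuclideanSpace ℝ (Fin R)` to the vector of limits

HONEST FRAMING: exact (Metropolis-corrected) sampling algorithms for lattice gauge theory;
figures of merit are autocorrelation/cost numbers at stated couplings and volumes; no
continuum-physics claim.

Venture `LatticeQCDFlow` (cell pub-lqcd), topic `Scoring`; FANOUT row 4 (`s0-u1-b`, GEN-32).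
NEW WORK of the cell (classical; not in Mathlib), no definition, nothing cited as a fact.
`Scoring/IndependentSumLimit.lean` / `Scoring/IndependentJointLimit.lean` treat TWO independent
statistics.  A card's error bar is often the between-REPLICA standard error over `R` independent
streams (`Scoring/ReplicaError.lean`), whose calibration at a FIXED `R` needs the joint limit of the
`R`-vector of replica statistics.  This file proves: (i) the sum over a `Finset` of a jointly
independent family of statistics, each converging in distribution, converges to the sum of the
(jointly independent) limits (induction with `tendstoInDistribution_add_of_indepFun` and Mathlib's
`iIndepFun.indepFun_finsetSum_of_notMem`); (ii) hence, by the Cramér–Wold device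
(`Scoring/CramerWoldDevice.lean`), the vector `(X_{r,n})_{r<R}` converges in distribution in
`EuclideanSpace ℝ (Fin R)` to `(Z_r)_{r<R}`; (iii) REPLICAS: statistics `X_{r,n}` of `R` codes / runs,
each converging under its own law `P_r`, read on the product space `⊗_r P_r` (where they are
independent, Mathlib's `iIndepFun_pi`) converge jointly to any independent family of the limits.

## Content

* `tendstoInDistribution_pi_eval` — a statistic of replica `r` keeps its limit when read on `⊗_r P_r`;
* **`tendstoInDistribution_finsetSum_of_iIndepFun`** — independent sums converge to the sum of limits;
* **`tendstoInDistribution_euclidean_of_iIndepFun`** — the vector version (Cramér–Wold);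
* **`tendstoInDistribution_replicas`** — `R` independent replicas on the product space.

NOT CLAIMED: dependent families; infinite families; rates.
-/

noncomputable section

namespace Summit.Ventures.LatticeQCDFlow.Scoring.CardConsistency

open MeasureTheory ProbabilityTheory Filter WithLp
open scoped Topology RealInnerProductSpace

/-! ## §1 One replica's statistic read on the product space -/

section Eval

variable {ι : Type*} [Fintype ι] {Ωs : ι → Type*} [∀ r, MeasurableSpace (Ωs r)]
  {Ps : (r : ι) → Measure (Ωs r)} [∀ r, IsProbabilityMeasure (Ps r)]
variable {Ω' : Type*} [MeasurableSpace Ω'] {P' : Measure Ω'} [IsProbabilityMeasure P']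
variable {S : Type*} [MeasurableSpace S] [TopologicalSpace S] [OpensMeasurableSpace S]

/-- A statistic of replica `r` keeps its limit when read on the product space `⊗_r P_r`. [ours] -/
theorem tendstoInDistribution_pi_eval (r : ι) {X : ℕ → Ωs r → S} {Z : Ω' → S}
    (hX : TendstoInDistribution X atTop Z (fun _ => Ps r) P') :
    TendstoInDistribution (fun n (ω : ∀ i, Ωs i) => X n (ω r)) atTop Z (fun _ => Measure.pi Ps) P' := by
  have hm : ∀ n, AEMeasurable (fun ω : ∀ i, Ωs i => X n (ω r)) (Measure.pi Ps) := fun n =>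
    (hX.forall_aemeasurable n).comp_quasiMeasurePreserving (Measure.quasiMeasurePreserving_eval _ r)
  refine ⟨hm, hX.aemeasurable_limit, ?_⟩
  have e : (fun n => (⟨(Measure.pi Ps).map fun ω : ∀ i, Ωs i => X n (ω r),
      Measure.isProbabilityMeasure_map (hm n)⟩ : ProbabilityMeasure S))
      = fun n => ⟨(Ps r).map (X n), Measure.isProbabilityMeasure_map (hX.forall_aemeasurable n)⟩ := by
    funext n
    apply Subtype.ext
    show (Measure.pi Ps).map (fun ω : ∀ i, Ωs i => X n (ω r)) = (Ps r).map (X n)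
    have h1 : AEMeasurable (X n) ((Measure.pi Ps).map (Function.eval r)) := by
      rw [(measurePreserving_eval Ps r).map_eq]
      exact hX.forall_aemeasurable n
    rw [show (fun ω : ∀ i, Ωs i => X n (ω r)) = X n ∘ Function.eval r from rfl,
      ← AEMeasurable.map_map_of_aemeasurable h1 (measurable_pi_apply r).aemeasurable,
      (measurePreserving_eval Ps r).map_eq]
  rw [e]
  exact hX.tendsto

end Eval

/-! ## §2 Sums and vectors of an independent family -/

section Family

variable {ι : Type*} {Ω : Type*} [MeasurableSpace Ω] {P : Measure Ω} [IsProbabilityMeasure P]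
variable {Ω' : Type*} [MeasurableSpace Ω'] {P' : Measure Ω'} [IsProbabilityMeasure P']

/-- **INDEPENDENT SUMS CONVERGE TO THE SUM OF THE INDEPENDENT LIMITS.**  `X_{r,n} ⇒ Z_r` for each
`r`, `(X_{r,n})_r` jointly independent for every `n`, `(Z_r)_r` jointly independent, all measurable ⇒
`Σ_{r∈s} X_{r,n} ⇒ Σ_{r∈s} Z_r`. [ours] -/
theorem tendstoInDistribution_finsetSum_of_iIndepFun [DecidableEq ι] {X : ι → ℕ → Ω → ℝ}
    {Z : ι → Ω' → ℝ} (hX : ∀ r, TendstoInDistribution (X r) atTop (Z r) (fun _ => P) P')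
    (hXm : ∀ r n, Measurable (X r n)) (hZm : ∀ r, Measurable (Z r))
    (hind : ∀ n, iIndepFun (fun r => X r n) P) (hZ : iIndepFun Z P') (s : Finset ι) :
    TendstoInDistribution (fun n ω => ∑ r ∈ s, X r n ω) atTop (fun ω' => ∑ r ∈ s, Z r ω')
      (fun _ => P) P' := by
  induction s using Finset.induction_on with
  | empty =>
    simp only [Finset.sum_empty]
    refine ⟨fun _ => aemeasurable_const, aemeasurable_const, ?_⟩
    have e : (P'.map fun _ : Ω' => (0 : ℝ)) = P.map fun _ : Ω => (0 : ℝ) := by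
      rw [Measure.map_const, Measure.map_const, measure_univ, measure_univ]
    convert tendsto_const_nhds using 2
    exact Subtype.ext e
  | @insert a s ha ih =>
    have h1 : ∀ n, IndepFun (fun ω => ∑ r ∈ s, X r n ω) (X a n) P := by
      intro n
      have h := (hind n).indepFun_finsetSum_of_notMem (fun r => hXm r n) ha
      have e : (∑ r ∈ s, fun ω => X r n ω) = fun ω => ∑ r ∈ s, X r n ω := by
        funext ω; simp only [Finset.sum_apply]
      rw [← e]
      exact h
    have h2 : IndepFun (fun ω' => ∑ r ∈ s, Z r ω') (Z a) P' := by
      have h := hZ.indepFun_finsetSum_of_notMem hZm ha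
      have e : (∑ r ∈ s, fun ω' => Z r ω') = fun ω' => ∑ r ∈ s, Z r ω' := by
        funext ω'; simp only [Finset.sum_apply]
      rw [← e]
      exact h
    have hsum := tendstoInDistribution_add_of_indepFun ih (hX a) h1 h2
    refine hsum.congr (fun n => Eventually.of_forall fun ω => ?_) (Eventually.of_forall fun ω' => ?_)
    · show ∑ r ∈ s, X r n ω + X a n ω = ∑ r ∈ insert a s, X r n ω
      rw [Finset.sum_insert ha, add_comm]
    · show ∑ r ∈ s, Z r ω' + Z a ω' = ∑ r ∈ insert a s, Z r ω'
      rw [Finset.sum_insert ha, add_comm]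

/-- **THE VECTOR OF AN INDEPENDENT FAMILY CONVERGES JOINTLY** (Cramér–Wold): under the
hypotheses of `tendstoInDistribution_finsetSum_of_iIndepFun` with index type `Fin R`,
`(X_{r,n})_{r<R} ⇒ (Z_r)_{r<R}` in `EuclideanSpace ℝ (Fin R)`. [ours] -/
theorem tendstoInDistribution_euclidean_of_iIndepFun {R : ℕ} {X : Fin R → ℕ → Ω → ℝ}
    {Z : Fin R → Ω' → ℝ} (hX : ∀ r, TendstoInDistribution (X r) atTop (Z r) (fun _ => P) P')
    (hXm : ∀ r n, Measurable (X r n)) (hZm : ∀ r, Measurable (Z r))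
    (hind : ∀ n, iIndepFun (fun r => X r n) P) (hZ : iIndepFun Z P') :
    TendstoInDistribution (fun n ω => (WithLp.toLp 2 (fun r => X r n ω) : EuclideanSpace ℝ (Fin R)))
      atTop (fun ω' => (WithLp.toLp 2 (fun r => Z r ω') : EuclideanSpace ℝ (Fin R))) (fun _ => P) P' := by
  have hVm : ∀ n, AEMeasurable (fun ω => (WithLp.toLp 2 (fun r => X r n ω) : EuclideanSpace ℝ (Fin R))) P :=
    fun n => ((WithLp.measurable_toLp 2 _).comp (measurable_pi_lambda _ fun r => hXm r n)).aemeasurable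
  have hVZ : AEMeasurable (fun ω' => (WithLp.toLp 2 (fun r => Z r ω') : EuclideanSpace ℝ (Fin R))) P' :=
    ((WithLp.measurable_toLp 2 _).comp (measurable_pi_lambda _ fun r => hZm r)).aemeasurable
  refine tendstoInDistribution_of_forall_inner (P := fun _ => P) hVm hVZ fun t => ?_
  -- `⟪t, X⟫ = Σ_r t_r X_r`, an independent sum
  have hX' : ∀ r, TendstoInDistribution (fun n ω => t r * X r n ω) atTop (fun ω' => t r * Z r ω')
      (fun _ => P) P' := fun r => (hX r).continuous_comp (continuous_const.mul continuous_id)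
  have hind' : ∀ n, iIndepFun (fun r ω => t r * X r n ω) P := fun n =>
    (hind n).comp (fun r x => t r * x) fun r => measurable_const_mul _
  have hZ' : iIndepFun (fun r ω' => t r * Z r ω') P' := hZ.comp (fun r x => t r * x) fun r => measurable_const_mul _
  have hsum := tendstoInDistribution_finsetSum_of_iIndepFun hX' (fun r n => (hXm r n).const_mul _)
    (fun r => (hZm r).const_mul _) hind' hZ' Finset.univ
  refine hsum.congr (fun n => Eventually.of_forall fun ω => ?_) (Eventually.of_forall fun ω' => ?_)
  · show ∑ r, t r * X r n ω = ⟪t, (WithLp.toLp 2 (fun r => X r n ω) : EuclideanSpace ℝ (Fin R))⟫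
    simp only [PiLp.inner_apply, RCLike.inner_apply, conj_trivial]
    refine Finset.sum_congr rfl fun r _ => ?_
    simp [mul_comm]
  · show ∑ r, t r * Z r ω' = ⟪t, (WithLp.toLp 2 (fun r => Z r ω') : EuclideanSpace ℝ (Fin R))⟫
    simp only [PiLp.inner_apply, RCLike.inner_apply, conj_trivial]
    refine Finset.sum_congr rfl fun r _ => ?_
    simp [mul_comm]

end Family

/-! ## §3 Replicas on the product space -/

section Replicas

variable {R : ℕ} {Ωs : Fin R → Type*} [∀ r, MeasurableSpace (Ωs r)]
  {Ps : (r : Fin R) → Measure (Ωs r)} [∀ r, IsProbabilityMeasure (Ps r)]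
variable {Ω' : Type*} [MeasurableSpace Ω'] {P' : Measure Ω'} [IsProbabilityMeasure P']

/-- **`R` INDEPENDENT REPLICAS CONVERGE JOINTLY.**  `X_{r,n} ⇒ Z_r` under `P_r` for each replica
`r`, `X_{r,n}` measurable, `(Z_r)_r` a jointly independent measurable family on `Ω'` ⇒ on the product
space `⊗_r P_r` the vector `(X_{r,n}(ω_r))_{r<R}` converges in distribution in `EuclideanSpace ℝ (Fin R)`
to `(Z_r)_{r<R}`. [ours] -/
theorem tendstoInDistribution_replicas {X : (r : Fin R) → ℕ → Ωs r → ℝ} {Z : Fin R → Ω' → ℝ}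
    (hX : ∀ r, TendstoInDistribution (X r) atTop (Z r) (fun _ => Ps r) P')
    (hXm : ∀ r n, Measurable (X r n)) (hZm : ∀ r, Measurable (Z r)) (hZ : iIndepFun Z P') :
    TendstoInDistribution (fun n (ω : ∀ r, Ωs r) =>
        (WithLp.toLp 2 (fun r => X r n (ω r)) : EuclideanSpace ℝ (Fin R)))
      atTop (fun ω' => (WithLp.toLp 2 (fun r => Z r ω') : EuclideanSpace ℝ (Fin R)))
      (fun _ => Measure.pi Ps) P' :=
  tendstoInDistribution_euclidean_of_iIndepFun (fun r => tendstoInDistribution_pi_eval r (hX r))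
    (fun r n => (hXm r n).comp (measurable_pi_apply r)) hZm
    (fun n => iIndepFun_pi fun r => (hXm r n).aemeasurable) hZ

end Replicas

end Summit.Ventures.LatticeQCDFlow.Scoring.CardConsistency

end
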